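import Literature.Probability.RandomPlanarGeometry.HexSAWPolygonCellsOmegaBase
import Literature.Probability.RandomPlanarGeometry.HexSAWPolygonCellsOmegaClosedForm
import HarnessLib

/-!
# Cell calculus for honeycomb polygon surgery, XLI: the base shapes unfolded, the port dichotomy, and CASE 2 of THEOREM I has identity rays

Topic `Literature/Probability/RandomPlanarGeometry` (lane «pcv-sawmu», a-p4 g23; sequel of XXX `…OmegaBase` (`baseImage`, `basePort`, `base_cases`,
`omegaImage`) and XXXIII `…OmegaClosedForm` (`omegaRec_image_eq`, `mem_omegaRec_iff`, `injOn_ray_and_disjoint`)).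

THEOREM I (injectivity of `ι = omegaImage`) splits at the top hexagon `w` of `W = ι S` (THEOREM-OMEGA-g21 §4): CASE 1 (`w` outside the base image —
a ray top; done in XXXIII–XXXIX) and CASE 2 (`w` inside the base image `C(B)`, `B = peel S`).  This file supplies the three structural facts CASE 2
rests on:
* `base_shapes` — the five shapes of the base data (class X flip, class R roof, the 3-chain `F₂`, RU flip, RU leaf) with the base image, the port
  table and the TOP HEXAGON of the base image made explicit (one `rcases` for all later files);
* ★ `basePort_eq_ur_or_above` — THE PORT DICHOTOMY: every base port is either the identity port `UR d` or lies lexicographically ABOVE the top hexagon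
  of the base image (the ports `UR (UL t)`, `UR a_k`, `UR (UL c_j)`, `UL c_i`, `UR (UL (UR p))` of the table of THEOREM-OMEGA §2);
  `ll_basePort_mem_or` — the contact below a port: `LL (port d) ∈ C(B)`, except for the `UL`-type ports of the RU leaf whose contact is `LR = d` with
  `L² d ∈ C(B)` (used by the CASE-1 exclusivity);
* ★★ `ll_port_eq_self_of_case2` — in CASE 2 every peeled hexagon is its own image (all present rays are identity rays), hence
  ★ `omegaImage_eq_of_case2 : ι S = C(B) ∪ (S \ B)` with `Disjoint (C B) (S \ B)`, and ★ `isHost_ll_of_case2` — in CASE 2 every peeled hexagon is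
  `UR` of a host of the base (all sticks have length one) and lies strictly below `w`.

Sources: N. Madras, G. Slade, *The Self-Avoiding Walk* (1993), §3.2, proof of Theorem 3.2.3 pp. 64–65 [MadrasSlade1993]; I. Jensen, J. Phys.: Conf. Ser.
42 (2006) 163, §2 [Jensen2006HoneycombPolygons].  Label (lane): LANE INFRASTRUCTURE for the lane's step-two injection (THEOREM I, CASE 2); nothing new in writing.
-/

open Finset

namespace Literature.Probability.RandomPlanarGeometry.SAW

namespace HexCell

/-! ### Small tools -/

/-- A row profile with its apex present makes the apex the top hexagon. [cite: MadrasSlade1993, §3.2 (proof of Theorem 3.2.3)] -/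
theorem isLexmax_of_rowProfile {C : Finset Cell} {Y u1 : ℤ} (hC : RowProfile C Y u1) (hm : ((u1, Y + 1) : Cell) ∈ C) :
    IsLexmax C (u1, Y + 1) := by
  refine ⟨hm, fun x hx => ?_⟩
  obtain ⟨h1, h2⟩ := hC x hx
  rcases lt_or_eq_of_le h1 with h | h
  · exact Or.inl h
  · exact Or.inr ⟨h, (h2 h).le⟩

/-- The top hexagon of `F₂ = {UL (UR p), UR p, R p, p}` is `UL (UR p)`. [cite: MadrasSlade1993, §3.2 (proof of Theorem 3.2.3)] -/
theorem isLexmax_F2 (p : Cell) : IsLexmax ({UL (UR p), UR p, R p, p} : Finset Cell) (UL (UR p)) := by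
  refine ⟨by simp, fun x hx => ?_⟩
  simp only [mem_insert, mem_singleton] at hx
  rcases hx with rfl | rfl | rfl | rfl
  · right; exact ⟨rfl, le_rfl⟩
  · left; simp
  · left; simp
  · left; simp

/-- `UL c` written in coordinates on the row above. [cite: Jensen2006HoneycombPolygons, §2] -/
theorem ul_eq_mk (c : Cell) : UL c = (c.1 - 1, c.2 + 1) := rfl

/-- The roof-end base `B₀ + a_k` sits inside `B₀ ∪ roof t₀ k`, hence inside the leaf image. [cite: MadrasSlade1993, §3.2 (proof of Theorem 3.2.3)] -/
theorem insert_roofCell_subset_ruLeafImage (B₀ : Finset Cell) (t₀ : Cell) {k : ℕ} (hk : 1 ≤ k) :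
    insert (roofCell t₀ (k - 1)) B₀ ⊆ ruLeafImage B₀ t₀ k :=
  (insert_roofCell_subset_union_roof B₀ t₀ hk).trans (subset_insert _ _)

/-- The roof-end base sits inside the flip image. [cite: MadrasSlade1993, §3.2 (proof of Theorem 3.2.3)] -/
theorem insert_roofCell_subset_ruFlipImage (B₀ : Finset Cell) (t₀ : Cell) (k : ℕ) :
    insert (roofCell t₀ (k - 1)) B₀ ⊆ ruFlipImage B₀ t₀ k :=
  subset_insert _ _

/-! ### The five shapes of the base data -/

/-- ★ **The base data unfolded.** For a brick set `B` with polygonal boundary, `#B ≥ 2` and no peelable top, exactly one of: class X (flip at the top `t`,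
top of the image `UL t`); class R (roof over the run, top `a_k = roofCell t (k−1)`, `k = runLen ≥ 1`); the 3-chain (image `F₂`, top `UL (UR p)`); the RU
flip or the RU leaf at the chain hexagon `c_j` over the roof-end base `B₀ + a_k` (top `UL c_j`) — with `baseImage`, `basePort` rewritten accordingly.
[cite: MadrasSlade1993, §3.2, Theorem 3.2.3 (3.2.3) and its proof (the cases at the lexicographically largest point)] -/
theorem base_shapes {B : Finset Cell} (hB : IsBrickSet B) (hP : IsPolygon brickWallGraph (bdry B)) (h2 : 2 ≤ #B) (hfix : peel B = B) :
    (L (topCell B) ∈ B ∧ baseImage B = flipImage B (topCell B) ∧ basePort B = portX (topCell B) ∧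
        IsLexmax (baseImage B) (UL (topCell B))) ∨
    (L (topCell B) ∉ B ∧ LR (topCell B) ∈ B ∧ baseImage B = roofImage B (topCell B) ∧ basePort B = portR (topCell B) (runLen B (topCell B)) ∧
        1 ≤ runLen B (topCell B) ∧ IsLexmax (baseImage B) (roofCell (topCell B) (runLen B (topCell B) - 1))) ∨
    (∃ p : Cell, B = {p, UR p, UR (UR p)} ∧ baseImage B = {UL (UR p), UR p, R p, p} ∧ (basePort B = fun _ => UR (UL (UR p))) ∧
        topCell B = UR (UR p) ∧ IsLexmax (baseImage B) (UL (UR p))) ∨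
    (∃ t₀ : Cell, ∃ k : ℕ, IsLexmax (B.erase (topCell B)) t₀ ∧ L t₀ ∉ B.erase (topCell B) ∧ 2 ≤ k ∧
        (∀ i < k, runCell t₀ i ∈ B.erase (topCell B)) ∧ runCell t₀ k ∉ B.erase (topCell B) ∧ topCell B = roofCell t₀ (k - 1) ∧
        B = insert (roofCell t₀ (k - 1)) (B.erase (topCell B)) ∧
        ((L (chainCell t₀ (chainIdx (B.erase (topCell B)) t₀)) ∈ B.erase (topCell B) ∧
            baseImage B = ruFlipImage (B.erase (topCell B)) t₀ k ∧ basePort B = ruFlipPort (B.erase (topCell B)) t₀ ∧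
            IsLexmax (baseImage B) (UL (chainCell t₀ (chainIdx (B.erase (topCell B)) t₀)))) ∨
          (L (chainCell t₀ (chainIdx (B.erase (topCell B)) t₀)) ∉ B.erase (topCell B) ∧
            baseImage B = ruLeafImage (B.erase (topCell B)) t₀ k ∧ basePort B = ruLeafPort (B.erase (topCell B)) t₀ ∧
            IsLexmax (baseImage B) (UL (chainCell t₀ (chainIdx (B.erase (topCell B)) t₀)))))) := by
  classical
  have hne : B.Nonempty := card_pos.1 (by omega)
  have ht := isLexmax_topCell hne
  rcases base_cases hB hP h2 hfix with hL | ⟨hL, hLR⟩ | ⟨hL, hLR, h3⟩ | hru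
  · -- class X
    have eI : baseImage B = flipImage B (topCell B) := by rw [baseImage, if_pos hL]
    have eP : basePort B = portX (topCell B) := by rw [basePort, if_pos hL]
    refine Or.inl ⟨hL, eI, eP, ?_⟩
    rw [eI]; exact isLexmax_flipImage ht
  · -- class R
    have eI : baseImage B = roofImage B (topCell B) := by rw [baseImage, if_neg hL, if_pos hLR]
    have eP : basePort B = portR (topCell B) (runLen B (topCell B)) := by rw [basePort, if_neg hL, if_pos hLR]
    refine Or.inr (Or.inl ⟨hL, hLR, eI, eP, one_le_runLen_iff.2 hLR, ?_⟩)
    rw [eI]; exact isLexmax_roofImage ht hLR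
  · -- the 3-chain
    have eI : baseImage B = {UL (UR (chain3Base h3)), UR (chain3Base h3), R (chain3Base h3), chain3Base h3} := by
      rw [baseImage, if_neg hL, if_neg hLR, dif_pos h3]
    have eP : basePort B = fun _ => UR (UL (UR (chain3Base h3))) := by rw [basePort, if_neg hL, if_neg hLR, dif_pos h3]
    refine Or.inr (Or.inr (Or.inl ⟨chain3Base h3, chain3Base_spec h3, eI, eP, ?_, ?_⟩))
    · -- the top of the 3-chain is `UR (UR p)`
      have e := chain3Base_spec h3
      have hmax : IsLexmax B (UR (UR (chain3Base h3))) := by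
        refine ⟨(Finset.ext_iff.1 e _).2 (by simp), fun x hx => ?_⟩
        have hx' := (Finset.ext_iff.1 e x).1 hx
        simp only [mem_insert, mem_singleton] at hx'
        rcases hx' with rfl | rfl | rfl
        · left; simp
        · left; simp
        · right; exact ⟨rfl, le_rfl⟩
      exact (hmax.eq_topCell).symm
    · rw [eI]; exact isLexmax_F2 _
  · -- the RU-family
    obtain ⟨ht₀, hL₀, hk, hrun, hend, hll⟩ := ruSpec hru
    have h3 : ¬ IsChain3 B := hru.2.2.1
    have hL : L (topCell B) ∉ B := hru.1
    have hLR : LR (topCell B) ∉ B := hru.2.1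
    have htop : topCell B = roofCell (ruTop hru) (ruLen hru - 1) := by
      rw [← ur_runCell, ← hll]; ext <;> simp
    have hBeq : B = insert (roofCell (ruTop hru) (ruLen hru - 1)) (B.erase (topCell B)) := by rw [← htop, insert_erase ht.1]
    refine Or.inr (Or.inr (Or.inr ⟨ruTop hru, ruLen hru, ht₀, hL₀, hk, hrun, hend, htop, hBeq, ?_⟩))
    have eUL : UL (chainCell (ruTop hru) (chainIdx (B.erase (topCell B)) (ruTop hru))) =
        ((chainCell (ruTop hru) (chainIdx (B.erase (topCell B)) (ruTop hru))).1 - 1, (ruTop hru).2 + 1) := Prod.ext rfl (by simp)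
    by_cases hfl : L (chainCell (ruTop hru) (chainIdx (B.erase (topCell B)) (ruTop hru))) ∈ B.erase (topCell B)
    · have eI : baseImage B = ruFlipImage (B.erase (topCell B)) (ruTop hru) (ruLen hru) := by
        rw [baseImage, if_neg hL, if_neg hLR, dif_neg h3, dif_pos hru, if_pos hfl]
      have eP : basePort B = ruFlipPort (B.erase (topCell B)) (ruTop hru) := by
        rw [basePort, if_neg hL, if_neg hLR, dif_neg h3, dif_pos hru, if_pos hfl]
      refine Or.inl ⟨hfl, eI, eP, ?_⟩
      rw [eI, eUL]
      exact isLexmax_of_rowProfile (rowProfile_ruFlipImage ht₀) (by rw [← eUL]; exact mem_insert_self _ _)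
    · have eI : baseImage B = ruLeafImage (B.erase (topCell B)) (ruTop hru) (ruLen hru) := by
        rw [baseImage, if_neg hL, if_neg hLR, dif_neg h3, dif_pos hru, if_neg hfl]
      have eP : basePort B = ruLeafPort (B.erase (topCell B)) (ruTop hru) := by
        rw [basePort, if_neg hL, if_neg hLR, dif_neg h3, dif_pos hru, if_neg hfl]
      refine Or.inr ⟨hfl, eI, eP, ?_⟩
      rw [eI, eUL]
      exact isLexmax_of_rowProfile (rowProfile_ruLeafImage ht₀) (by rw [← eUL]; exact mem_insert_self _ _)

/-! ### The port dichotomy -/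

/-- ★ **THE PORT DICHOTOMY**: every base port is the identity port `UR d`, or it lies lexicographically strictly ABOVE the top hexagon of the base image.
(Table of THEOREM-OMEGA-g21 §2: `UR (UL t)` is two rows above `t`; `UR a_k` one row above `a_k`; `UR (UL c_j)` above `UL c_j`; the leaf ports `UL c_i`,
`i < j`, on the row of `UL c_j` to its right; `UR (UL (UR p))` above `F₂`.) [cite: MadrasSlade1993, §3.2 (proof of Theorem 3.2.3)] -/
theorem basePort_eq_ur_or_above {B : Finset Cell} (hB : IsBrickSet B) (hP : IsPolygon brickWallGraph (bdry B)) (h2 : 2 ≤ #B) (hfix : peel B = B)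
    (d : Cell) :
    basePort B d = UR d ∨ ((topCell (baseImage B)).2 < (basePort B d).2 ∨
      ((topCell (baseImage B)).2 = (basePort B d).2 ∧ (topCell (baseImage B)).1 < (basePort B d).1)) := by
  rcases base_shapes hB hP h2 hfix with ⟨-, -, eP, hmax⟩ | ⟨-, -, -, eP, -, hmax⟩ | ⟨p, -, -, eP, -, hmax⟩ |
      ⟨t₀, k, -, -, -, -, -, -, -, hsub⟩
  · rw [← hmax.eq_topCell, eP, portX]
    split_ifs with h
    · subst h; right; left; simp
    · left; rfl
  · rw [← hmax.eq_topCell, eP, portR]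
    split_ifs with h
    · right; left; simp
    · left; rfl
  · rw [← hmax.eq_topCell, eP]; right; left; simp
  · rcases hsub with ⟨-, -, eP, hmax⟩ | ⟨-, -, eP, hmax⟩
    · rw [← hmax.eq_topCell, eP, ruFlipPort]
      split_ifs with h
      · subst h; right; left; simp
      · left; rfl
    · rw [← hmax.eq_topCell, eP, ruLeafPort]
      split_ifs with h h'
      · subst h; right; left; simp
      · right; right
        obtain ⟨hrow, hx, -⟩ := h'
        simp only [UL_snd, chainCell_snd, UL_fst]
        exact ⟨by omega, by omega⟩
      · left; rfl

/-- ★ **The contact below a port**: `LL (basePort B d) ∈ baseImage B` for every `d ∈ B` — except for the `UL`-type ports of the RU leaf (`d = c_i`, `i < j`),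
where `basePort B d = UL d`, `d ∈ baseImage B` and `L (L d) = c_{i+1} ∈ baseImage B`. [cite: MadrasSlade1993, §3.2 (proof of Theorem 3.2.3)] -/
theorem ll_basePort_mem_or {B : Finset Cell} (hB : IsBrickSet B) (hP : IsPolygon brickWallGraph (bdry B)) (h2 : 2 ≤ #B) (hfix : peel B = B)
    {d : Cell} (hd : d ∈ B) :
    LL (basePort B d) ∈ baseImage B ∨ (basePort B d = UL d ∧ d ∈ baseImage B ∧ L (L d) ∈ baseImage B) := by
  rcases base_shapes hB hP h2 hfix with ⟨-, eI, eP, -⟩ | ⟨-, -, eI, eP, hk, -⟩ | ⟨p, -, eI, eP, -, -⟩ |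
      ⟨t₀, k, ht₀, -, hk, -, -, htop, hBeq, hsub⟩
  · left; rw [eI, eP, portX, flipImage]
    split_ifs with h
    · rw [ll_ur]; exact mem_insert_self _ _
    · rw [ll_ur]; exact mem_insert_of_mem hd
  · left; rw [eI, eP, portR, roofImage]
    split_ifs with h
    · rw [ll_ur]; exact mem_union_right _ (mem_roof.2 ⟨_, by omega, rfl⟩)
    · rw [ll_ur]; exact mem_union_left _ hd
  · left; rw [eI, eP, ll_ur]; simp
  · rcases hsub with ⟨-, eI, eP, -⟩ | ⟨-, eI, eP, -⟩
    · left; rw [eI, eP, ruFlipPort]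
      split_ifs with h
      · rw [ll_ur, h]; exact mem_insert_self _ _
      · rw [ll_ur]; apply insert_roofCell_subset_ruFlipImage; rw [← hBeq]; exact hd
    · rw [eI, eP, ruLeafPort]
      split_ifs with h h'
      · left; rw [ll_ur, h]; exact mem_insert_self _ _
      · right
        obtain ⟨hrow, hx, hle⟩ := h'
        -- `d` is a base hexagon on the top row of `B₀` right of `c_j`: a chain hexagon `c_i`, `i < j`
        have hdB₀ : d ∈ B.erase (topCell B) := by
          rw [mem_erase]; refine ⟨fun e => ?_, hd⟩
          rw [e, htop, roofCell_fst] at hle; omega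
        have hbrick₀ : IsBrickSet (B.erase (topCell B)) := fun c hc => hB c (mem_of_mem_erase hc)
        obtain ⟨i, hi, rfl⟩ := mem_topRow_right_of_chain hbrick₀ ht₀ hdB₀ hrow hx
        have hsub := insert_roofCell_subset_ruLeafImage (B.erase (topCell B)) t₀ (k := k) (by omega)
        refine ⟨rfl, hsub (by rw [← hBeq]; exact hd), hsub (mem_insert_of_mem ?_)⟩
        rw [← chainCell_succ]; exact chainCell_mem ht₀.1 (by omega)
      · left; rw [ll_ur]; apply insert_roofCell_subset_ruLeafImage _ _ (by omega); rw [← hBeq]; exact hd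

/-- Every base hexagon lies in the base image, except for the 3-chain (`UR (UR p) ∉ F₂`): for the four other shapes `B ⊆ baseImage B`.
Stated as: `d ∈ B`, `d ∉ baseImage B` ⇒ `B` is the 3-chain. [cite: MadrasSlade1993, §3.2 (proof of Theorem 3.2.3)] -/
theorem isChain3_of_not_mem_baseImage {B : Finset Cell} (hB : IsBrickSet B) (hP : IsPolygon brickWallGraph (bdry B)) (h2 : 2 ≤ #B)
    (hfix : peel B = B) {d : Cell} (hd : d ∈ B) (hdC : d ∉ baseImage B) : IsChain3 B := by
  rcases base_shapes hB hP h2 hfix with ⟨-, eI, -, -⟩ | ⟨-, -, eI, -, -, -⟩ | ⟨p, eB, -, -, -, -⟩ | ⟨t₀, k, -, -, hk, -, -, -, hBeq, hsub⟩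
  · rw [eI] at hdC; exact absurd (subset_flipImage _ _ hd) hdC
  · rw [eI] at hdC; exact absurd (subset_roofImage _ _ hd) hdC
  · exact ⟨p, eB⟩
  · rcases hsub with ⟨-, eI, -, -⟩ | ⟨-, eI, -, -⟩
    · rw [eI] at hdC; exact absurd (insert_roofCell_subset_ruFlipImage _ _ _ (by rw [← hBeq]; exact hd)) hdC
    · rw [eI] at hdC; exact absurd (insert_roofCell_subset_ruLeafImage _ _ (by omega) (by rw [← hBeq]; exact hd)) hdC

/-- **Rows of the base image**: every hexagon of `baseImage B` lies on a row `≤ (topCell B).y + 1`, and on the row `(topCell B).y + 1` strictly left of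
`topCell B`. [cite: MadrasSlade1993, §3.2 (proof of Theorem 3.2.3)] -/
theorem row_of_mem_baseImage {B : Finset Cell} (hB : IsBrickSet B) (hP : IsPolygon brickWallGraph (bdry B)) (h2 : 2 ≤ #B) (hfix : peel B = B)
    {x : Cell} (hx : x ∈ baseImage B) : x.2 ≤ (topCell B).2 + 1 ∧ (x.2 = (topCell B).2 + 1 → x.1 < (topCell B).1) := by
  classical
  have hne : B.Nonempty := card_pos.1 (by omega)
  have ht := isLexmax_topCell hne
  rcases base_shapes hB hP h2 hfix with ⟨-, eI, -, -⟩ | ⟨-, hLR, eI, -, -, -⟩ | ⟨p, -, eI, -, etop, -⟩ | ⟨t₀, k, ht₀, -, hk, -, -, htop, -, hsub⟩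
  · rw [eI, flipImage, mem_insert] at hx
    rcases hx with rfl | hx
    · simp
    · rcases ht.2 x hx with h | ⟨h, -⟩ <;> exact ⟨by omega, fun e => by omega⟩
  · rw [eI, roofImage, mem_union] at hx
    rcases hx with hx | hx
    · rcases ht.2 x hx with h | ⟨h, -⟩ <;> exact ⟨by omega, fun e => by omega⟩
    · obtain ⟨i, -, rfl⟩ := mem_roof.1 hx
      simp
  · rw [etop]; rw [eI] at hx
    simp only [mem_insert, mem_singleton] at hx
    rcases hx with rfl | rfl | rfl | rfl
    all_goals simp
    all_goals omega
  · have hrow : (topCell B).2 = t₀.2 := by rw [htop, roofCell_snd]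
    have hxt : (topCell B).1 = t₀.1 + 2 * ((k - 1 : ℕ) : ℤ) + 2 := by rw [htop, roofCell_fst]
    have hcj : (chainCell t₀ (chainIdx (B.erase (topCell B)) t₀)).1 ≤ t₀.1 := by simp
    rcases hsub with ⟨-, eI, -, -⟩ | ⟨-, eI, -, -⟩
    · rw [eI] at hx
      obtain ⟨h1, h2⟩ := rowProfile_ruFlipImage (k := k) ht₀ x hx
      exact ⟨by omega, fun e => by have := h2 (by omega); omega⟩
    · rw [eI] at hx
      obtain ⟨h1, h2⟩ := rowProfile_ruLeafImage (k := k) ht₀ x hx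
      exact ⟨by omega, fun e => by have := h2 (by omega); omega⟩

/-! ### CASE 2 has identity rays -/

section Case2

variable {S : Finset Cell} {w : Cell}

/-- The base of a brick set with polygonal boundary and `#peel ≥ 2` satisfies the hypotheses of `base_shapes`.
[cite: MadrasSlade1993, §3.2 (proof of Theorem 3.2.3)] -/
theorem peel_hyps (hS : IsBrickSet S) (hP : IsPolygon brickWallGraph (bdry S)) :
    IsBrickSet (peel S) ∧ IsPolygon brickWallGraph (bdry (peel S)) ∧ peel (peel S) = peel S :=
  ⟨isBrickSet_peel hS, isPolygon_bdry_peel hS hP, peel_eq_self_iff.2 (not_exists_peelable_peel S)⟩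

/-- The base image is part of the image. [cite: MadrasSlade1993, §3.2 (proof of Theorem 3.2.3)] -/
theorem baseImage_subset_omegaImage (S : Finset Cell) : baseImage (peel S) ⊆ omegaImage S := by
  intro x hx; rw [omegaImage, omegaRec_image_eq]; exact mem_union_left _ hx

/-- In CASE 2 the top hexagon of the image is the top hexagon of the base image. [cite: MadrasSlade1993, §3.2 (proof of Theorem 3.2.3)] -/
theorem eq_topCell_baseImage_of_case2 (hw : IsLexmax (omegaImage S) w) (hwC : w ∈ baseImage (peel S)) :
    w = topCell (baseImage (peel S)) :=
  IsLexmax.eq_topCell ⟨hwC, fun x hx => hw.2 x (baseImage_subset_omegaImage S hx)⟩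

/-- A ray hexagon of the closed form is in the image and outside the base image. [cite: MadrasSlade1993, §3.2 (proof of Theorem 3.2.3)] -/
theorem ray_mem_and_notMem (hS : IsBrickSet S) (hP : IsPolygon brickWallGraph (bdry S)) (h2 : 2 ≤ #(peel S)) {m : Cell}
    (hm : m ∈ S \ peel S) :
    LL ((omegaRec baseImage basePort S).2 m) ∈ omegaImage S ∧ LL ((omegaRec baseImage basePort S).2 m) ∉ baseImage (peel S) := by
  classical
  obtain ⟨hb, hpoly, hfix⟩ := peel_hyps hS hP
  obtain ⟨hinv, -, -⟩ := base_data hb hpoly h2 hfix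
  have hmem : LL ((omegaRec baseImage basePort S).2 m) ∈ (S \ peel S).image (fun m => LL ((omegaRec baseImage basePort S).2 m)) :=
    mem_image_of_mem _ hm
  refine ⟨by rw [omegaImage, omegaRec_image_eq]; exact mem_union_right _ hmem, fun hC => ?_⟩
  exact (disjoint_left.1 (injOn_ray_and_disjoint (C := baseImage) (P₀ := basePort) hS (omega_hX hS) hinv).2) hC hmem

/-- ★★ **CASE 2 has identity rays**: if the top hexagon `w` of `ι S` lies in the base image, then every peeled hexagon `m ∈ S \ peel S` is its own
image, `LL (P_S m) = m` — its host's port is the identity port, for a non-identity port lies above the top of the base image (`basePort_eq_ur_or_above`)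
and so would its ray, contradicting the maximality of `w`. [cite: MadrasSlade1993, §3.2 (proof of Theorem 3.2.3)] -/
theorem ll_port_eq_self_of_case2 (hS : IsBrickSet S) (hP : IsPolygon brickWallGraph (bdry S)) (h2 : 2 ≤ #(peel S))
    (hw : IsLexmax (omegaImage S) w) (hwC : w ∈ baseImage (peel S)) {m : Cell} (hm : m ∈ S \ peel S) :
    LL ((omegaRec baseImage basePort S).2 m) = m := by
  classical
  obtain ⟨hb, hpoly, hfix⟩ := peel_hyps hS hP
  obtain ⟨hxW, hxC⟩ := ray_mem_and_notMem hS hP h2 hm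
  obtain ⟨h, i, hhost, hi, rfl, hst⟩ := exists_host_stick_of_mem_sdiff_peel hm
  obtain ⟨i, rfl⟩ : ∃ i', i = i' + 1 := ⟨i - 1, by omega⟩
  rw [ll_omegaRec_port_urIter_succ hhost.1 hst] at hxW hxC ⊢
  rcases basePort_eq_ur_or_above hb hpoly h2 hfix h with e | habove
  · rw [e, urIter_ur]
  · exfalso
    rw [← eq_topCell_baseImage_of_case2 hw hwC] at habove
    have hne : urIter (basePort (peel S) h) i ≠ w := fun e => hxC (e ▸ hwC)
    have hle := hw.2 _ hxW
    obtain ⟨a, b⟩ := w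
    simp only [urIter, ne_eq, Prod.mk.injEq] at hle hne habove
    rcases hle with hle | ⟨hle1, hle2⟩
    · rcases habove with h1 | ⟨h1, h2⟩ <;> omega
    · rcases habove with h1 | ⟨h1, h2⟩
      · omega
      · exact hne ⟨by omega, by omega⟩

/-- ★ **The image in CASE 2**: `ι S = C(B) ∪ (S \ B)`. [cite: MadrasSlade1993, §3.2 (proof of Theorem 3.2.3)] -/
theorem omegaImage_eq_of_case2 (hS : IsBrickSet S) (hP : IsPolygon brickWallGraph (bdry S)) (h2 : 2 ≤ #(peel S))
    (hw : IsLexmax (omegaImage S) w) (hwC : w ∈ baseImage (peel S)) : omegaImage S = baseImage (peel S) ∪ (S \ peel S) := by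
  classical
  rw [omegaImage, omegaRec_image_eq]
  congr 1
  rw [image_congr (g := id) (fun m hm => ?_), image_id]
  exact ll_port_eq_self_of_case2 hS hP h2 hw hwC (mem_coe.1 hm)

/-- ★ In CASE 2 the peeled hexagons miss the base image. [cite: MadrasSlade1993, §3.2 (proof of Theorem 3.2.3)] -/
theorem disjoint_baseImage_sdiff_of_case2 (hS : IsBrickSet S) (hP : IsPolygon brickWallGraph (bdry S)) (h2 : 2 ≤ #(peel S))
    (hw : IsLexmax (omegaImage S) w) (hwC : w ∈ baseImage (peel S)) : Disjoint (baseImage (peel S)) (S \ peel S) := by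
  classical
  rw [disjoint_right]
  intro m hm hC
  have := (ray_mem_and_notMem hS hP h2 hm).2
  rw [ll_port_eq_self_of_case2 hS hP h2 hw hwC hm] at this
  exact this hC

/-- In CASE 2 a peeled hexagon lies strictly below the top hexagon `w` of the image (it is in the image and not in the base image).
[cite: MadrasSlade1993, §3.2 (proof of Theorem 3.2.3)] -/
theorem lt_top_of_case2 (hS : IsBrickSet S) (hP : IsPolygon brickWallGraph (bdry S)) (h2 : 2 ≤ #(peel S))
    (hw : IsLexmax (omegaImage S) w) (hwC : w ∈ baseImage (peel S)) {m : Cell} (hm : m ∈ S \ peel S) :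
    m.2 < w.2 ∨ (m.2 = w.2 ∧ m.1 < w.1) := by
  obtain ⟨hxW, hxC⟩ := ray_mem_and_notMem hS hP h2 hm
  rw [ll_port_eq_self_of_case2 hS hP h2 hw hwC hm] at hxW hxC
  have hne : m ≠ w := fun e => hxC (e ▸ hwC)
  rcases hw.2 m hxW with h | ⟨h1, h2⟩
  · exact Or.inl h
  · right; refine ⟨h1, lt_of_le_of_ne h2 fun e => hne (Prod.ext e h1)⟩

/-- ★ **In CASE 2 all sticks have length one**: every peeled hexagon `m` stands directly on a host of the base, `IsHost (peel S) (LL m)`.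
(A second stick hexagon would lie on a row `≥ y + 1`, `y` the top row of the base, at abscissa `≥ t.x + 5` or higher — not below the top of the base
image, which is on a row `≤ y + 1` left of `t`.) [cite: MadrasSlade1993, §3.2 (proof of Theorem 3.2.3)] -/
theorem isHost_ll_of_case2 (hS : IsBrickSet S) (hP : IsPolygon brickWallGraph (bdry S)) (h2 : 2 ≤ #(peel S))
    (hw : IsLexmax (omegaImage S) w) (hwC : w ∈ baseImage (peel S)) {m : Cell} (hm : m ∈ S \ peel S) : IsHost (peel S) (LL m) := by
  classical
  obtain ⟨hb, hpoly, hfix⟩ := peel_hyps hS hP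
  have hne : (peel S).Nonempty := card_pos.1 (by omega)
  have ht := isLexmax_topCell hne
  obtain ⟨h, i, hhost, hi, hm', hst⟩ := exists_host_stick_of_mem_sdiff_peel hm
  obtain ⟨i, rfl⟩ : ∃ i', i = i' + 1 := ⟨i - 1, by omega⟩
  rcases Nat.eq_zero_or_pos i with rfl | hpos
  · -- `LL (urIter h 1) = h`
    have e : LL m = h := by rw [← hm', ll_urIter_succ, urIter_zero]
    rw [e]; exact hhost
  · exfalso
    -- the second stick hexagon `urIter h 2 ≼ m` is too high
    have hm2 : urIter h (i + 1) ∈ S \ peel S := hst (i + 1) (by omega) le_rfl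
    rw [hm'] at hm2
    have hlt := lt_top_of_case2 hS hP h2 hw hwC hm
    have hwrow := row_of_mem_baseImage hb hpoly h2 hfix hwC
    rcases hhost.row_cases hb ht with ⟨hrow, hxle, -⟩ | ⟨hrow, hx⟩
    · -- top-row host: `m` on row `y + i + 1 ≥ y + 2`
      rw [← hm'] at hlt; simp only [urIter] at hlt; omega
    · rw [← hm'] at hlt; simp only [urIter] at hlt
      rcases hlt with hlt | ⟨hlt1, hlt2⟩
      · omega
      · have := hwrow.2 (by omega); omega

end Case2

end HexCell

end Literature.Probability.RandomPlanarGeometry.SAW
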